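import Literature.AlgebraicGeometry.HodgeTheory.FermatHodgeCharacterCancel
import HarnessLib

/-!
# The odd-world peel for general configurations (engine, version 2)

Support file XIV (everything PROVED; no named facts, no definitions) for the structure theorem of
the Hodge characters of the Fermat surface (`AokiShioda1983_thmB2m_standard`).

Generalisation of the first step of [Aoki1983, Prop. 8.2] (file `QuadTop`) to configurations
`∑ᵢ cᵢ [xᵢ]` indexed by an arbitrary finite type, with the annihilation hypothesis in PRODUCT FORM:
`∑ᵢ cᵢ (χ₁ ⊠ χ')(xᵢ) = 0` for all `χ₁` mod `q` not factoring through a chosen `d ∣ q` and all `χ'`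
mod `n` in a chosen class `𝒮'`, of odd product parity. This covers (a) primitive characters
(`d = p^(e-1)`), (b) the characters of full support (`d = p`), whose relations come from the Hodge
condition at the lower levels with the same radical, and (c) longer configurations (the `6`- and
`8`-point configurations of [Aoki1983, Props. 8.4, 8.9]).
* `odd_rel_of_free` : the slice relation at a free `±`-class (Lemma 3.2 + Fourier on `(ℤ/q)ˣ`);
* `odd_rel_avatar` : the same relation written as an all-parity relation for the avatars
  `εᵢ xᵢ mod n`;
* `exists_free_pm_of_card_lt`, `exists_free_pm_of_coset` : free classes by counting.
[cite: Aoki1983, Lemma 3.2, Props. 3.3, 8.2–8.4]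

## References

* [Aoki1983] N. Aoki, Math. Ann. 266 (1983) 23–54, §3 and §8 (text read).
-/

noncomputable section

open Finset

namespace Literature.AlgebraicGeometry.HodgeTheory

namespace FermatCharacter

section EngineV2

variable {q n : ℕ} [NeZero q] [NeZero n] {ι : Type*} [Fintype ι]

/-- **The odd-world slice relation (general form).** Points `xᵢ` (units mod `q n`) with
coefficients `cᵢ`; assume `∑ cᵢ (χ₁ ⊠ χ')(xᵢ) = 0` for every `χ₁` mod `q` not factoring through
`d` and every `χ'` in the class `𝒮'` with `χ₁(-1) χ'(-1) = -1`. If the `±`-class of the unit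
residue `y` mod `q` is free (some kernel translate `±u y` avoids all residues), then for every
`χ' ∈ 𝒮'`: `∑_{xᵢ ≡ y} cᵢ χ'(xᵢ) - χ'(-1) ∑_{xᵢ ≡ -y} cᵢ χ'(xᵢ) = 0`. [cite: Aoki1983, Lemma 3.2] -/
theorem odd_rel_of_free {d : ℕ} (hd : d ∣ q) (𝒮' : DirichletCharacter ℂ n → Prop)
    (x : ι → (ZMod (q * n))ˣ) (c : ι → ℂ)
    (hT : ∀ (χ₁ : DirichletCharacter ℂ q) (χ' : DirichletCharacter ℂ n),
      ¬ χ₁.FactorsThrough d → 𝒮' χ' → χ₁ (-1) * χ' (-1) = -1 →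
      ∑ i, c i * (DirichletCharacter.changeLevel (dvd_mul_right q n) χ₁ *
        DirichletCharacter.changeLevel (dvd_mul_left n q) χ') (x i) = 0)
    (y u : (ZMod q)ˣ) (hu : ZMod.unitsMap hd u = 1)
    (hfree : ∀ i, ZMod.castHom (dvd_mul_right q n) (ZMod q) (x i) ≠ (u : ZMod q) * y ∧
      ZMod.castHom (dvd_mul_right q n) (ZMod q) (x i) ≠ -((u : ZMod q) * y))
    (χ' : DirichletCharacter ℂ n) (hχ' : 𝒮' χ') :
    (∑ i, (if ZMod.castHom (dvd_mul_right q n) (ZMod q) (x i) = y then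
        c i * χ' (ZMod.castHom (dvd_mul_left n q) (ZMod n) (x i)) else 0)) -
      χ' (-1) * ∑ i, (if ZMod.castHom (dvd_mul_right q n) (ZMod q) (x i) = -(y : ZMod q) then
        c i * χ' (ZMod.castHom (dvd_mul_left n q) (ZMod n) (x i)) else 0) = 0 := by
  classical
  haveI : NeZero (q * n) := ⟨mul_ne_zero (NeZero.ne q) (NeZero.ne n)⟩
  set F : ZMod q → ℂ := fun ρ ↦ ∑ i, (if ZMod.castHom (dvd_mul_right q n) (ZMod q) (x i) = ρ then
      c i * χ' (ZMod.castHom (dvd_mul_left n q) (ZMod n) (x i)) else 0) with hF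
  have hη2 : χ' (-1) * χ' (-1) = 1 := by rw [← map_mul, neg_one_mul, neg_neg, map_one]
  have hε : -χ' (-1) = 1 ∨ -χ' (-1) = -1 := by
    rcases χ'.even_or_odd with he | ho
    · right; rw [he]
    · left; rw [ho]; norm_num
  have horth : ∀ χ₁ : DirichletCharacter ℂ q, χ₁ (-1) = -χ' (-1) → ¬ χ₁.FactorsThrough d →
      ∑ ρ : ZMod q, F ρ * χ₁ ρ = 0 := by
    intro χ₁ hpar hχ₁
    have hodd : χ₁ (-1) * χ' (-1) = -1 := by rw [hpar]; linear_combination -hη2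
    have key := hT χ₁ χ' hχ₁ hχ' hodd
    simp_rw [prodChar_apply] at key
    have hcomm : ∑ ρ : ZMod q, F ρ * χ₁ ρ = ∑ i, c i * (χ₁ (ZMod.castHom (dvd_mul_right q n) (ZMod q) (x i)) *
        χ' (ZMod.castHom (dvd_mul_left n q) (ZMod n) (x i))) := by
      simp only [hF, Finset.sum_mul]
      rw [Finset.sum_comm]
      refine Finset.sum_congr rfl fun i _ ↦ ?_
      rw [Finset.sum_eq_single_of_mem (ZMod.castHom (dvd_mul_right q n) (ZMod q) (x i)) (mem_univ _)
        (fun ρ _ hρ ↦ by rw [if_neg (Ne.symm hρ), zero_mul]), if_pos rfl]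
      ring
    rw [hcomm]
    exact key
  have key := parityPart_mul_eq_of_orthogonal hd F hε horth u y hu
  have h1 : F ((u : ZMod q) * y) = 0 := Finset.sum_eq_zero fun i _ ↦ if_neg (hfree i).1
  have h2 : F (-((u : ZMod q) * y)) = 0 := Finset.sum_eq_zero fun i _ ↦ if_neg (hfree i).2
  rw [h1, h2, mul_zero, add_zero] at key
  linear_combination -key

omit [NeZero q] [NeZero n] in
/-- **The slice relation in avatar form.** With `εᵢ = 1, pᵢ = xᵢ mod n` if `xᵢ ≡ y (mod q)` and
`εᵢ = -1, pᵢ = -xᵢ mod n` if `xᵢ ≡ -y`, the relation of `odd_rel_of_free` reads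
`∑_{xᵢ ≡ ±y} cᵢ εᵢ χ'(pᵢ) = 0` — a relation without parity twist. [cite: Aoki1983, Prop. 8.2] -/
theorem odd_rel_avatar [Fact (1 < q)] (hq : IsUnit (2 : ZMod q)) (x : ι → (ZMod (q * n))ˣ)
    (c : ι → ℂ) (y : (ZMod q)ˣ) (χ' : DirichletCharacter ℂ n)
    (hrel : (∑ i, (if ZMod.castHom (dvd_mul_right q n) (ZMod q) (x i) = y then
        c i * χ' (ZMod.castHom (dvd_mul_left n q) (ZMod n) (x i)) else 0)) -
      χ' (-1) * ∑ i, (if ZMod.castHom (dvd_mul_right q n) (ZMod q) (x i) = -(y : ZMod q) then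
        c i * χ' (ZMod.castHom (dvd_mul_left n q) (ZMod n) (x i)) else 0) = 0) :
    ∑ i, (if ZMod.castHom (dvd_mul_right q n) (ZMod q) (x i) = y ∨
        ZMod.castHom (dvd_mul_right q n) (ZMod q) (x i) = -(y : ZMod q) then
      c i * (if ZMod.castHom (dvd_mul_right q n) (ZMod q) (x i) = y then 1 else -1) *
        χ' (if ZMod.castHom (dvd_mul_right q n) (ZMod q) (x i) = y then
          ZMod.castHom (dvd_mul_left n q) (ZMod n) (x i)
          else -ZMod.castHom (dvd_mul_left n q) (ZMod n) (x i)) else 0) = 0 := by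
  classical
  have hyy : (y : ZMod q) ≠ -(y : ZMod q) := by
    intro he
    have h2 : (2 : ZMod q) * y = 0 := by linear_combination he
    exact (hq.mul (Units.isUnit y)).ne_zero h2
  rw [Finset.mul_sum, ← Finset.sum_sub_distrib] at hrel
  refine Eq.trans (Finset.sum_congr rfl fun i _ ↦ ?_) hrel
  by_cases h1 : ZMod.castHom (dvd_mul_right q n) (ZMod q) (x i) = y
  · have h2 : ¬ ZMod.castHom (dvd_mul_right q n) (ZMod q) (x i) = -(y : ZMod q) :=
      fun h' ↦ hyy (h1.symm.trans h')
    rw [if_pos (Or.inl h1), if_pos h1, if_pos h1, if_pos h1, if_neg h2]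
    ring
  · by_cases h2 : ZMod.castHom (dvd_mul_right q n) (ZMod q) (x i) = -(y : ZMod q)
    · rw [if_pos (Or.inr h2), if_neg h1, if_neg h1, if_neg h1, if_pos h2, ← neg_one_mul
        (ZMod.castHom (dvd_mul_left n q) (ZMod n) (x i) : ZMod n), map_mul]
      ring
    · rw [if_neg (not_or.mpr ⟨h1, h2⟩), if_neg h1, if_neg h2]
      ring

omit [NeZero n] in
/-- **Free `±`-classes by counting (general form).** If the kernel has more than `2 · #ι`
elements, every `±`-class is free. [folklore] -/
theorem exists_free_pm_of_card_lt {d : ℕ} (hd : d ∣ q)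
    (hker : 2 * Fintype.card ι < #(univ.filter fun u : (ZMod q)ˣ ↦ ZMod.unitsMap hd u = 1))
    (ρ : ι → (ZMod q)ˣ) (y : (ZMod q)ˣ) :
    ∃ u : (ZMod q)ˣ, ZMod.unitsMap hd u = 1 ∧
      ∀ i, (ρ i : ZMod q) ≠ (u : ZMod q) * y ∧ (ρ i : ZMod q) ≠ -((u : ZMod q) * y) := by
  classical
  by_contra hcon
  push Not at hcon
  set g : ι × Bool → (ZMod q)ˣ := fun ib ↦ if ib.2 then ρ ib.1 * y⁻¹ else -(ρ ib.1 * y⁻¹) with hg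
  have hsub : univ.filter (fun u : (ZMod q)ˣ ↦ ZMod.unitsMap hd u = 1) ⊆ univ.image g := by
    intro u hu
    rw [mem_filter] at hu
    obtain ⟨i, hi⟩ := hcon u hu.2
    rw [mem_image]
    by_cases h1 : (ρ i : ZMod q) = (u : ZMod q) * y
    · refine ⟨(i, true), mem_univ _, ?_⟩
      simp only [hg, if_true]
      rw [mul_inv_eq_iff_eq_mul]
      exact Units.ext (by rw [Units.val_mul]; exact h1)
    · have h2 := hi h1
      refine ⟨(i, false), mem_univ _, ?_⟩
      simp only [hg, Bool.false_eq_true, if_false]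
      rw [neg_eq_iff_eq_neg, mul_inv_eq_iff_eq_mul]
      apply Units.ext
      rw [Units.val_mul, Units.val_neg, h2]; ring
  have := Finset.card_le_card hsub
  have h8 : #(univ.image g) ≤ 2 * Fintype.card ι :=
    le_trans Finset.card_image_le (by simp [Fintype.card_prod, mul_comm])
  omega

omit [NeZero n] in
/-- **Free `±`-classes at a kernel not containing `-1`.** If `-1 ∉ ker` and the kernel has more
than `#ι` elements, every `±`-class is free (each point excludes at most one kernel element).
[folklore] -/
theorem exists_free_pm_of_coset {d : ℕ} (hd : d ∣ q) (hm1 : ZMod.unitsMap hd (-1) ≠ 1)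
    (hker : Fintype.card ι < #(univ.filter fun u : (ZMod q)ˣ ↦ ZMod.unitsMap hd u = 1))
    (ρ : ι → (ZMod q)ˣ) (y : (ZMod q)ˣ) :
    ∃ u : (ZMod q)ˣ, ZMod.unitsMap hd u = 1 ∧
      ∀ i, (ρ i : ZMod q) ≠ (u : ZMod q) * y ∧ (ρ i : ZMod q) ≠ -((u : ZMod q) * y) := by
  classical
  by_contra hcon
  push Not at hcon
  set g : ι → (ZMod q)ˣ := fun i ↦
    if ZMod.unitsMap hd (ρ i * y⁻¹) = 1 then ρ i * y⁻¹ else -(ρ i * y⁻¹) with hg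
  have hsub : univ.filter (fun u : (ZMod q)ˣ ↦ ZMod.unitsMap hd u = 1) ⊆ univ.image g := by
    intro u hu
    rw [mem_filter] at hu
    obtain ⟨i, hi⟩ := hcon u hu.2
    rw [mem_image]
    refine ⟨i, mem_univ _, ?_⟩
    by_cases h1 : (ρ i : ZMod q) = (u : ZMod q) * y
    · have hu' : ρ i * y⁻¹ = u := by
        rw [mul_inv_eq_iff_eq_mul]
        exact Units.ext (by rw [Units.val_mul]; exact h1)
      simp only [hg, hu', hu.2, if_true]
    · have h2 := hi h1
      have hu' : -(ρ i * y⁻¹) = u := by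
        rw [neg_eq_iff_eq_neg, mul_inv_eq_iff_eq_mul]
        apply Units.ext
        rw [Units.val_mul, Units.val_neg, h2]; ring
      have hnot : ZMod.unitsMap hd (ρ i * y⁻¹) ≠ 1 := by
        intro h3
        apply hm1
        have : (-1 : (ZMod q)ˣ) = -(ρ i * y⁻¹) * (ρ i * y⁻¹)⁻¹ := by rw [neg_mul, mul_inv_cancel]
        rw [this, map_mul, map_inv, hu', hu.2, h3, inv_one, one_mul]
      simp only [hg, if_neg hnot, hu']
  have := Finset.card_le_card hsub
  have h4 : #(univ.image g) ≤ Fintype.card ι := le_trans Finset.card_image_le (by simp)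
  omega

/-- An index whose `±`-class mod `q` contains no other point is contradictory (general form:
nonzero coefficient, some character in the class `𝒮'`). [cite: Aoki1983, Prop. 8.2] -/
theorem odd_alone_false [Fact (1 < q)] {d : ℕ} (hd : d ∣ q) (𝒮' : DirichletCharacter ℂ n → Prop)
    (h𝒮 : ∃ χ' : DirichletCharacter ℂ n, 𝒮' χ') (hq : IsUnit (2 : ZMod q))
    (x : ι → (ZMod (q * n))ˣ) (c : ι → ℂ)
    (hT : ∀ (χ₁ : DirichletCharacter ℂ q) (χ' : DirichletCharacter ℂ n),
      ¬ χ₁.FactorsThrough d → 𝒮' χ' → χ₁ (-1) * χ' (-1) = -1 →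
      ∑ i, c i * (DirichletCharacter.changeLevel (dvd_mul_right q n) χ₁ *
        DirichletCharacter.changeLevel (dvd_mul_left n q) χ') (x i) = 0)
    (hfreeAll : ∀ y : (ZMod q)ˣ, ∃ u : (ZMod q)ˣ, ZMod.unitsMap hd u = 1 ∧
      ∀ i, ZMod.castHom (dvd_mul_right q n) (ZMod q) (x i) ≠ (u : ZMod q) * y ∧
        ZMod.castHom (dvd_mul_right q n) (ZMod q) (x i) ≠ -((u : ZMod q) * y))
    (a : ι) (hca : c a ≠ 0) (halone : ∀ j, j ≠ a →
      ZMod.castHom (dvd_mul_right q n) (ZMod q) (x j) ≠ ZMod.castHom (dvd_mul_right q n) (ZMod q) (x a) ∧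
      ZMod.castHom (dvd_mul_right q n) (ZMod q) (x j) ≠ -ZMod.castHom (dvd_mul_right q n) (ZMod q) (x a)) :
    False := by
  classical
  obtain ⟨χ', hχ'⟩ := h𝒮
  obtain ⟨u, hu, hfu⟩ := hfreeAll (ZMod.unitsMap (dvd_mul_right q n) (x a))
  have rel := odd_rel_of_free hd 𝒮' x c hT _ u hu hfu χ' hχ'
  rw [coe_unitsMap] at rel
  have hself : ZMod.castHom (dvd_mul_right q n) (ZMod q) (x a) ≠
      -ZMod.castHom (dvd_mul_right q n) (ZMod q) (x a) := by
    intro he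
    have h2 : (2 : ZMod q) * ZMod.castHom (dvd_mul_right q n) (ZMod q) (x a) = 0 := by
      linear_combination he
    exact (hq.mul ((Units.isUnit (x a)).map _)).ne_zero h2
  rw [Finset.sum_eq_single_of_mem a (mem_univ _) (fun j _ hj ↦ if_neg (halone j hj).1), if_pos rfl,
    Finset.sum_eq_zero (fun j _ ↦ ?_), mul_zero, sub_zero] at rel
  · have h1 := DirichletCharacter.unit_norm_eq_one χ' (ZMod.unitsMap (dvd_mul_left n q) (x a))
    rw [coe_unitsMap] at h1
    rcases mul_eq_zero.mp rel with h0 | h0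
    · exact hca h0
    · rw [h0, norm_zero] at h1; exact zero_ne_one h1
  · by_cases hj : j = a
    · rw [hj, if_neg hself]
    · rw [if_neg (halone j hj).2]

/-- **An isolated two-point block is an annihilated pair** (general form, conclusion in product
form for the same class of characters). [cite: Aoki1983, Prop. 8.2] -/
theorem odd_pair_of_block' [Fact (1 < q)] {d : ℕ} (hd : d ∣ q) (𝒮' : DirichletCharacter ℂ n → Prop)
    (hq : IsUnit (2 : ZMod q)) (x : ι → (ZMod (q * n))ˣ) (c : ι → ℂ)
    (hT : ∀ (χ₁ : DirichletCharacter ℂ q) (χ' : DirichletCharacter ℂ n),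
      ¬ χ₁.FactorsThrough d → 𝒮' χ' → χ₁ (-1) * χ' (-1) = -1 →
      ∑ i, c i * (DirichletCharacter.changeLevel (dvd_mul_right q n) χ₁ *
        DirichletCharacter.changeLevel (dvd_mul_left n q) χ') (x i) = 0)
    (hfreeAll : ∀ y : (ZMod q)ˣ, ∃ u : (ZMod q)ˣ, ZMod.unitsMap hd u = 1 ∧
      ∀ i, ZMod.castHom (dvd_mul_right q n) (ZMod q) (x i) ≠ (u : ZMod q) * y ∧
        ZMod.castHom (dvd_mul_right q n) (ZMod q) (x i) ≠ -((u : ZMod q) * y))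
    (a b : ι) (hab : a ≠ b)
    (hb : ZMod.castHom (dvd_mul_right q n) (ZMod q) (x b) = ZMod.castHom (dvd_mul_right q n) (ZMod q) (x a) ∨
      ZMod.castHom (dvd_mul_right q n) (ZMod q) (x b) = -ZMod.castHom (dvd_mul_right q n) (ZMod q) (x a))
    (hother : ∀ j, j ≠ a → j ≠ b →
      ZMod.castHom (dvd_mul_right q n) (ZMod q) (x j) ≠ ZMod.castHom (dvd_mul_right q n) (ZMod q) (x a) ∧
      ZMod.castHom (dvd_mul_right q n) (ZMod q) (x j) ≠ -ZMod.castHom (dvd_mul_right q n) (ZMod q) (x a))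
    (χ₁ : DirichletCharacter ℂ q) (χ' : DirichletCharacter ℂ n) (h𝒮 : 𝒮' χ')
    (hpar : χ₁ (-1) * χ' (-1) = -1) :
    c a * (DirichletCharacter.changeLevel (dvd_mul_right q n) χ₁ *
        DirichletCharacter.changeLevel (dvd_mul_left n q) χ') (x a) +
      c b * (DirichletCharacter.changeLevel (dvd_mul_right q n) χ₁ *
        DirichletCharacter.changeLevel (dvd_mul_left n q) χ') (x b) = 0 := by
  classical
  haveI : NeZero (q * n) := ⟨mul_ne_zero (NeZero.ne q) (NeZero.ne n)⟩
  set ra := ZMod.castHom (dvd_mul_right q n) (ZMod q) (x a) with hra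
  have hrau : IsUnit ra := by rw [hra]; exact (Units.isUnit (x a)).map _
  have hself : ra ≠ -ra := by
    intro he
    have h2 : (2 : ZMod q) * ra = 0 := by linear_combination he
    exact (hq.mul hrau).ne_zero h2
  obtain ⟨u, hu, hfu⟩ := hfreeAll (ZMod.unitsMap (dvd_mul_right q n) (x a))
  have rel := odd_rel_of_free hd 𝒮' x c hT _ u hu hfu χ' h𝒮
  rw [coe_unitsMap, ← hra] at rel
  rw [prodChar_apply, prodChar_apply, ← hra]
  rcases hb with hb | hb
  · rw [Finset.sum_eq_add_of_mem a b (mem_univ _) (mem_univ _) hab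
        (fun j _ hj ↦ if_neg (hother j hj.1 hj.2).1),
      if_pos rfl, if_pos hb, Finset.sum_eq_zero (fun j _ ↦ ?_), mul_zero, sub_zero] at rel
    · rw [hb]; linear_combination χ₁ ra * rel
    · by_cases hja : j = a
      · rw [hja, if_neg hself]
      by_cases hjb : j = b
      · rw [hjb, if_neg (fun h' ↦ hself (hb.symm.trans h'))]
      rw [if_neg (hother j hja hjb).2]
  · rw [Finset.sum_eq_single_of_mem a (mem_univ _), if_pos rfl,
      Finset.sum_eq_single_of_mem b (mem_univ _), if_pos hb] at rel
    · rw [hb, ← neg_one_mul ra, map_mul]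
      have hη2 : χ' (-1) * χ' (-1) = 1 := by rw [← map_mul, neg_one_mul, neg_neg, map_one]
      have hq1 : χ₁ (-1) = -χ' (-1) := by linear_combination χ' (-1) * hpar - χ₁ (-1) * hη2
      linear_combination χ₁ ra * rel +
        (c b * χ₁ ra * χ' (ZMod.castHom (dvd_mul_left n q) (ZMod n) (x b))) * hq1
    · intro j _ hjb
      by_cases hja : j = a
      · rw [hja, if_neg hself]
      rw [if_neg (hother j hja hjb).2]
    · intro j _ hja
      by_cases hjb : j = b
      · rw [hjb, if_neg (fun h' ↦ hself (hb.symm.trans h').symm)]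
      rw [if_neg (hother j hja hjb).1]

/-- Knowledge in product form from annihilation by the odd primitive characters (the case
`d = p^(e-1)`, `𝒮' =` primitive). [cite: Aoki1983, Prop. 3.1] -/
theorem prodForm_of_odd_primitive (h : q.Coprime n) {d : ℕ} (_hd : d ∣ q)
    (hprim : ∀ χ : DirichletCharacter ℂ q, ¬ χ.FactorsThrough d → χ.IsPrimitive)
    (x : ι → (ZMod (q * n))ˣ) (c : ι → ℂ)
    (hT : ∀ χ : DirichletCharacter ℂ (q * n), χ.Odd → χ.IsPrimitive → ∑ i, c i * χ (x i) = 0)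
    (χ₁ : DirichletCharacter ℂ q) (χ' : DirichletCharacter ℂ n) (h1 : ¬ χ₁.FactorsThrough d)
    (h2 : χ'.IsPrimitive) (hpar : χ₁ (-1) * χ' (-1) = -1) :
    ∑ i, c i * (DirichletCharacter.changeLevel (dvd_mul_right q n) χ₁ *
      DirichletCharacter.changeLevel (dvd_mul_left n q) χ') (x i) = 0 := by
  haveI : NeZero (q * n) := ⟨mul_ne_zero (NeZero.ne q) (NeZero.ne n)⟩
  refine hT _ ?_ (prodChar_isPrimitive h (hprim χ₁ h1) h2)
  rw [DirichletCharacter.Odd, prodChar_neg_one, hpar]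

end EngineV2

end FermatCharacter

end Literature.AlgebraicGeometry.HodgeTheory
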